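import Summits.BirchSwinnertonDyer.BirchSwinnertonDyer.Theses.TwistFamilyManinDescent
import Summits.BirchSwinnertonDyer.Rank1Residual.ManinAdditive.TwistOrbitDegreeIdentity
import Literature.NumberTheory.EllipticCurves.IsogenyIdProofs
import HarnessLib

/-!
# Route `TwistFamilyManinDescent` — the ASSEMBLY (stmt-BirchSwinnertonDyer-25142) closed by name

HONEST FRAMING. The assembly is the pure case analysis
`KatoIharaCremonaFacts → TwistFamilyDescent → IsogenyTableFamiliesManinOne → LargePrimeReducibleJ →
IrreducibleAdditiveManinUnit → EisensteinAdditiveManinResidual → ManinPrimeToAdditiveFiveLe` (X₅ of route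
`ManinLocalTwoThree`: Manin's `p`-part at every additive `p ≥ 5`, GIVEN the printed semistable facts and modularity).
Every input stays a HYPOTHESIS (two of them — the isogeny-table families 25137 and the Eisenstein residual 25138 —
are OPEN cruxes; the bundle carries the cite-only F″, Ihara³, Cremona ≤ 5·10⁵). Nothing about Manin's conjecture or
BSD is proved by this file.

THE CASES (for `W` globally minimal, `D` lattice-optimal at level `N`, `p ≥ 5`, `p² ∣ N`; the level is the conductor
by modularity, so `W` is additive at `p`):
* `E[p]` irreducible ⟹ `IrreducibleAdditiveManinUnit` (Kato road; F″, Ihara³ from the bundle).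
* `E[p]` reducible, `W ⊗ χ_{p*}` good or multiplicative at `p` ⟹ the tree's
  `not_dvd_maninConstant_of_isSemistableAt_quadraticTwist_pStar` (Stevens' twist transport; Mazur / Abbes–Ullmo /
  Česnavičius / modularity as displayed hypotheses).
* `E[p]` reducible, twist-minimal additive, `p ∈ {5, 7, 13}` or (`p = 163`, `2⁶ ∣ N`) ⟹ `EisensteinAdditiveManinResidual`
  (the declared residual, verbatim).
* otherwise `p ≥ 11`, `p ≠ 13`: `LargePrimeReducibleJ` puts `(p, j(W))` in the tree's `largePrimeIsogenyJTable`
  (Mazur–Kenku), so `j(W)` is one of the eleven table values (for `j(−163)` with `2⁶ ∤ N`), and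
  `IsogenyTableFamiliesManinOne` gives the class Manin certificate `|c| = 1`, whence `p ∤ c`
  (`ClassAbsManinConstantEqOne.not_dvd_maninConstant`). `TwistFamilyDescent` is consumed only through
  `IsogenyTableFamiliesManinOne` (it is that item's engine) and is carried here as displayed.
-/

-- D-0017: single-problem summit, so `Summit.BirchSwinnertonDyer.BirchSwinnertonDyer.…` repeats a namespace BY DESIGN.
set_option linter.dupNamespace false
set_option autoImplicit false

noncomputable section

open scoped Classical

open WeierstrassCurve IsDedekindDomain Rat.HeightOneSpectrum
  Literature.NumberTheory.EllipticCurves Literature.NumberTheory.EllipticCurves.ModularForms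
  Literature.NumberTheory.EllipticCurves.Rank1Residual
  Summit.BirchSwinnertonDyer.BirchSwinnertonDyer.Theses.TwistFamilyManinDescent

namespace Summit.BirchSwinnertonDyer.BirchSwinnertonDyer.Theorems.TwistFamilyManinDescent

/-- A prime `p ≥ 5` other than `5` and `7` is `≥ 11`. [elementary] -/
private theorem eleven_le_of_prime {p : ℕ} (hp : p.Prime) (h5 : 5 ≤ p) (h5' : p ≠ 5) (h7 : p ≠ 7) :
    11 ≤ p := by
  by_contra h
  interval_cases p <;> first | exact absurd rfl h5' | exact absurd rfl h7 | exact absurd hp (by decide)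

/-- **Item stmt-BirchSwinnertonDyer-25142 by name: the ASSEMBLY of route `TwistFamilyManinDescent`.** The case
analysis of the module docstring: irreducible ⟹ Kato road; reducible with semistable `p*`-twist ⟹ Stevens
transport; reducible twist-minimal at `p ∈ {5,7,13}` / the `2⁶`-corner of `163` ⟹ the declared residual; the
remaining reducible rows (`p ≥ 11`, `p ≠ 13`) sit in the Mazur–Kenku isogeny table and are certified by
`IsogenyTableFamiliesManinOne`. Pure logic over tree theorems; every crux/bundle stays a hypothesis.
[cite: Mazur1978, Thm. 1] [cite: Kenku1982, Thm. 1] [cite: Stevens1989, Lemmas (5.2), (5.4)]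
[cite: AgasheRibetStein2006, Thm. 2.6] -/
theorem assembly_proof : Assembly := by
  unfold Assembly
  intro hF _hT hJ hL hI hR
  unfold ManinPrimeToAdditiveFiveLe
  intro hM hAU hC2 hnf W _ _ N _ D hopt p hp hp5 hsq
  haveI := Fact.mk hp
  have hp2 : p ≠ 2 := by omega
  -- the level is the conductor, so `W` is additive at `p`
  have hN : N = W.conductorNorm ℤ := IsNewformOf.level_eq_conductorNorm_of_exists_isNewformOf hnf D.isNewformOf
  have hsqW : p ^ 2 ∣ W.conductorNorm ℤ := hN ▸ hsq
  have hadd : Addv W p :=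
    Summit.BirchSwinnertonDyer.Rank1Residual.ManinAdditive.not_good_and_not_mult_of_sq_dvd_conductorNorm W hsqW
  by_cases hirr : Irr W p
  · -- the Kato road (F″, Ihara³ from the bundle)
    exact hI hnf hF.1 hF.2.1 W p D hp5 hadd hirr hopt
  by_cases hsemi :
      (W.quadraticTwist (((-1 : ℤ) ^ (p / 2) * p : ℤ) : ℚ)).HasGoodReductionAt ((primesEquiv (R := ℤ)).symm ⟨p, hp⟩) ∨
        (W.quadraticTwist (((-1 : ℤ) ^ (p / 2) * p : ℤ) : ℚ)).HasMultiplicativeReductionAt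
          ((primesEquiv (R := ℤ)).symm ⟨p, hp⟩)
  · -- the `p*`-twist is semistable at `p`: Stevens transport
    exact not_dvd_maninConstant_of_isSemistableAt_quadraticTwist_pStar hM hAU hC2 hnf D hopt hp hp2 hsq hsemi
  by_cases hres : p = 5 ∨ p = 7 ∨ p = 13 ∨ (p = 163 ∧ 2 ^ 6 ∣ N)
  · -- the declared residual
    exact hR hM hAU hC2 hnf W D p hp hres hsq hirr hsemi hopt
  -- the isogeny-table rows: `p ≥ 11`, `p ≠ 13`
  have h5 : p ≠ 5 := fun h ↦ hres (Or.inl h)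
  have h7 : p ≠ 7 := fun h ↦ hres (Or.inr (Or.inl h))
  have h13 : p ≠ 13 := fun h ↦ hres (Or.inr (Or.inr (Or.inl h)))
  have h163 : p = 163 → ¬ 2 ^ 6 ∣ W.conductorNorm ℤ := fun h h64 ↦
    hres (Or.inr (Or.inr (Or.inr ⟨h, hN ▸ h64⟩)))
  have hp11 : 11 ≤ p := eleven_le_of_prime hp hp5 h5 h7
  have hmem := hL W p hp11 h13 hirr
  have hclass : ClassAbsManinConstantEqOne W := by
    refine hJ hnf hF.2.2 W ?_
    simp only [largePrimeIsogenyJTable, Finset.mem_insert, Finset.mem_singleton, Prod.mk.injEq] at hmem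
    rcases hmem with ⟨-, hj⟩ | ⟨-, hj⟩ | ⟨-, hj⟩ | ⟨-, hj⟩ | ⟨-, hj⟩ | ⟨-, hj⟩ | ⟨-, hj⟩ | ⟨-, hj⟩ | ⟨-, hj⟩ |
        ⟨-, hj⟩ | ⟨h163', hj⟩
    all_goals first
      | exact Or.inr ⟨hj, h163 h163'⟩
      | (left; rw [hj]; simp)
  exact hclass.not_dvd_maninConstant D (isIsogenous_self W) hopt hp

end Summit.BirchSwinnertonDyer.BirchSwinnertonDyer.Theorems.TwistFamilyManinDescent

end
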